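import Mathlib
import Literature.Computability.AlgebraicComplexity.RazElusiveGeneralProofs
import Summits.ValiantsHypothesis.ValiantsHypothesis.Theorems.SoloInformedQuadSpanReduction
import HarnessLib

/-!
# Pattern designs: monomial set-family maps that are poly(n)-definable with an EMPTY Boolean sum
(solo seat `solo-ValiantsHypothesis-informed`, s27)

This file discharges the definability hypothesis `hdef` of the univariate reduction
`soloInformed_vp_ne_vnp_of_quadSpanBound_cor58` (`SoloInformedQuadSpanReduction.lean`) for a new
class of designs, replacing the Reed–Solomon graph designs of the note (`paper/quadspan.md` §2.5(c))
whose membership test needs finite-field arithmetic.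

* `SoloPattern n L` — a PATTERN DESIGN on `n` positions read by `L` index bits: position `t`
  carries a set of bit positions `P t ⊆ Fin L` and a pattern `v t`; the `i`-th set of the family is
  `S i = {t | ∀ p ∈ P t, bit_p(i) = v t p}`.  Its monomial map `f_i = ∏_{t ∈ S i} x_t`
  (`soloDesignMap`) satisfies Raz's Def. 1.3 (`IsPolyDefinableMap`) with `ℓ = 0` and the witness
  `g = ∏_t (1 + (x_t - 1) · ∏_{p ∈ P t} lit_p(w))`, a product of literals in the index-bit
  variables `w` — no Boolean circuit and no Cook–Levin transcript are needed
  (`soloInformed_isPolyDefinableMap_pattern`, for any family of pattern designs along `n` with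
  `⌈log₂ m n⌉` polynomially bounded).
* `SoloPattern.subpattern n L K` — the SUBPATTERN DESIGN: the positions encode the pairs
  `(J, u)`, `J` a `(K-1)`-subset of the `L` bit positions and `u ∈ {0,1}^{K-1}` a pattern on `J`
  (`C(L, K-1) · 2^{K-1}` positions; unused positions carry the empty pattern); `S i` = all
  `(K-1)`-sub-patterns of the bit string of `i`.  It has PRIVATE POINTS TO ORDER `K`
  (`SoloPattern.subpattern_privatePoints`): among `≤ K` distinct indices `< 2^L`, a member `i`
  differs from each of the `≤ K - 1` others at some bit; a `(K-1)`-set `J` containing those bits,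
  with `i`'s own pattern on `J`, is a position of `S i` missed by all the others.  (This is the
  elementary `(K-1)`-cover-free family of all small sub-patterns; cf. Kautz–Singleton 1964 for the
  coding-theoretic context.  Private points give `(K, h)`-sign-independence for every `h`,
  `SoloDesign.ofPrivatePoints`.)

Nothing here is credited toward the summit: these are the combinatorial and definability bricks
used by `SoloInformedQuadSpanClosed.lean` to remove the side hypotheses of the reduction.

References: R. Raz, Theory of Computing 6 (2010) 135–177, Def. 1.3 and the remark following it;
W. H. Kautz, R. C. Singleton, IEEE Trans. Inform. Theory 10 (1964) 363–377 (superimposed codes).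
-/

noncomputable section

open MvPolynomial Finset

namespace Summit.ValiantsHypothesis.ValiantsHypothesis.Theorems

open Literature.Computability.AlgebraicComplexity

/-- **A pattern design** on `n` positions read by `L` index bits: position `t` tests the bits in
`P t` against the pattern `v t`. -/
structure SoloPattern (n L : ℕ) where
  /-- the bit positions tested at position `t` -/
  P : Fin n → Finset (Fin L)
  /-- the required bit values at position `t` (only the values on `P t` matter) -/
  v : Fin n → Fin L → Bool

namespace SoloPattern

variable {n L : ℕ} (D : SoloPattern n L)

/-- The `i`-th set of the family: the positions whose pattern the bits of `i` match. -/
def S (i : ℕ) : Finset (Fin n) :=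
  univ.filter fun t => ∀ p ∈ D.P t, i.testBit p = D.v t p

/-- Membership in `S i`. -/
theorem mem_S {i : ℕ} {t : Fin n} : t ∈ D.S i ↔ ∀ p ∈ D.P t, i.testBit p = D.v t p := by
  simp [S]

/-- One literal: `w_p` if the required bit is `1`, else `1 - w_p` (in the variables
`(x ⊕ (no e's)) ⊕ w` of `IsPolyDefinableMap` with `ℓ = 0`). -/
def literal (b : Bool) (p : Fin L) : MvPolynomial ((Fin n ⊕ Fin 0) ⊕ Fin L) ℂ :=
  if b then X (Sum.inr p) else 1 - X (Sum.inr p)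

/-- The pattern test of position `t` as a product of literals. -/
def lit (t : Fin n) : MvPolynomial ((Fin n ⊕ Fin 0) ⊕ Fin L) ℂ :=
  ∏ p ∈ D.P t, literal (n := n) (D.v t p) p

/-- The Def. 1.3 witness of the design map: `g = ∏_t (1 + (x_t - 1) · lit t)`. -/
def witness : MvPolynomial ((Fin n ⊕ Fin 0) ⊕ Fin L) ℂ :=
  ∏ t : Fin n, (1 + (X (Sum.inl (Sum.inl t)) - 1) * D.lit t)

/-! ### Substituting the bits of the index -/

/-- The bit substitution of `IsPolyDefinableMap` (`ℓ = 0`, `L` index bits). -/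
abbrev bits (n L i : ℕ) : MvPolynomial ((Fin n ⊕ Fin 0) ⊕ Fin L) ℂ →ₐ[ℂ]
    MvPolynomial (Fin n ⊕ Fin 0) ℂ :=
  aeval (Sum.elim X fun p : Fin L => if i.testBit p then (1 : MvPolynomial (Fin n ⊕ Fin 0) ℂ) else 0)

/-- Substituting the bits of `i` into a literal gives `1` or `0` according to the bit. -/
theorem bits_literal (i : ℕ) (b : Bool) (p : Fin L) :
    bits n L i (literal (n := n) b p) = if i.testBit p = b then 1 else 0 := by
  unfold literal
  cases b <;> cases h : i.testBit p <;> simp [h]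

/-- Substituting the bits of `i` into `lit t` gives the indicator of `t ∈ S i`. -/
theorem bits_lit (i : ℕ) (t : Fin n) :
    bits n L i (D.lit t) = if (∀ p ∈ D.P t, i.testBit p = D.v t p) then 1 else 0 := by
  classical
  unfold lit
  rw [map_prod]
  simp_rw [bits_literal]
  by_cases h : ∀ p ∈ D.P t, i.testBit p = D.v t p
  · rw [if_pos h]
    exact Finset.prod_eq_one fun p hp => by rw [if_pos (h p hp)]
  · rw [if_neg h]
    push Not at h
    obtain ⟨p, hp, hne⟩ := h
    exact Finset.prod_eq_zero hp (by rw [if_neg hne])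

/-- **The bit substitution turns the witness into the design monomial** (transported to the
variables `x ⊕ (no e's)`). -/
theorem bits_witness (i : ℕ) :
    bits n L i D.witness = rename Sum.inl (∏ t ∈ D.S i, (X t : MvPolynomial (Fin n) ℂ)) := by
  classical
  unfold witness
  rw [map_prod, map_prod]
  have hfac : ∀ t : Fin n, bits n L i (1 + (X (Sum.inl (Sum.inl t)) - 1) * D.lit t) =
      if (∀ p ∈ D.P t, i.testBit p = D.v t p) then X (Sum.inl t) else 1 := by
    intro t
    rw [map_add, map_mul, map_sub, map_one, bits_lit, aeval_X, Sum.elim_inl]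
    split_ifs <;> ring
  simp_rw [hfac, rename_X]
  rw [← Finset.prod_filter]
  rfl

/-- `bitSubst n 0 L i` is `bits n L i`. -/
theorem bitSubst_eq_bits (i : ℕ) :
    bitSubst (k := ℂ) (σ := fun n => Fin n) n 0 L i = bits n L i := rfl

/-! ### Degree and complexity of the witness -/

/-- A literal has total degree `≤ 1`. -/
theorem totalDegree_literal_le (b : Bool) (p : Fin L) :
    (literal (n := n) b p).totalDegree ≤ 1 := by
  unfold literal
  split_ifs
  · exact (totalDegree_X _).le
  · exact (totalDegree_sub _ _).trans (max_le (by simp) (totalDegree_X _).le)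

/-- `lit t` has total degree `≤ L`. -/
theorem totalDegree_lit_le (t : Fin n) : (D.lit t).totalDegree ≤ L := by
  unfold lit
  refine (totalDegree_finsetProd _ _).trans ?_
  calc ∑ p ∈ D.P t, (literal (n := n) (D.v t p) p).totalDegree ≤ ∑ _p ∈ D.P t, 1 :=
        Finset.sum_le_sum fun p _ => totalDegree_literal_le _ _
    _ = (D.P t).card := by simp
    _ ≤ L := by simpa using Finset.card_le_univ (D.P t)

/-- The witness has total degree `≤ n * (L + 1)`. -/
theorem totalDegree_witness_le : D.witness.totalDegree ≤ n * (L + 1) := by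
  unfold witness
  refine (totalDegree_finsetProd _ _).trans ?_
  calc ∑ t : Fin n, (1 + (X (Sum.inl (Sum.inl t)) - 1) * D.lit t).totalDegree
      ≤ ∑ _t : Fin n, (L + 1) := by
        refine Finset.sum_le_sum fun t _ => ?_
        refine (totalDegree_add _ _).trans (max_le (by simp) ?_)
        refine (totalDegree_mul _ _).trans ?_
        have h1 : (X (Sum.inl (Sum.inl t)) - 1 : MvPolynomial ((Fin n ⊕ Fin 0) ⊕ Fin L) ℂ).totalDegree
            ≤ 1 := (totalDegree_sub _ _).trans (max_le (totalDegree_X _).le (by simp))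
        have h2 := D.totalDegree_lit_le t
        omega
    _ = n * (L + 1) := by simp

/-- A literal has complexity `≤ 2`. -/
theorem complexity_literal_le (b : Bool) (p : Fin L) :
    complexity (literal (n := n) b p) ≤ 2 := by
  unfold literal
  split_ifs
  · rw [complexity_X_holds]; exact Nat.zero_le _
  · have h1 : (1 - X (Sum.inr p) : MvPolynomial ((Fin n ⊕ Fin 0) ⊕ Fin L) ℂ) =
        C 1 + (-1 : ℂ) • X (Sum.inr p) := by
      rw [neg_one_smul, C_1, sub_eq_add_neg]
    rw [h1]
    calc complexity (C 1 + (-1 : ℂ) • X (Sum.inr p) : MvPolynomial ((Fin n ⊕ Fin 0) ⊕ Fin L) ℂ)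
        ≤ complexity (C 1 : MvPolynomial ((Fin n ⊕ Fin 0) ⊕ Fin L) ℂ) +
            complexity ((-1 : ℂ) • X (Sum.inr p) : MvPolynomial ((Fin n ⊕ Fin 0) ⊕ Fin L) ℂ) + 1 :=
          complexity_add_le_holds _ _
      _ ≤ 0 + (0 + 1) + 1 := by
          gcongr
          · exact (complexity_C_holds (σ := (Fin n ⊕ Fin 0) ⊕ Fin L) (1 : ℂ)).le
          · exact (complexity_smul_le_holds _ _).trans (by rw [complexity_X_holds])
      _ = 2 := rfl

/-- `lit t` has complexity `≤ 3 * L`. -/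
theorem complexity_lit_le (t : Fin n) : complexity (D.lit t) ≤ 3 * L := by
  unfold lit
  refine (complexity_finset_prod_le _ _).trans ?_
  calc ∑ p ∈ D.P t, complexity (literal (n := n) (D.v t p) p) + (D.P t).card
      ≤ ∑ _p ∈ D.P t, 2 + (D.P t).card :=
        Nat.add_le_add_right (Finset.sum_le_sum fun p _ => complexity_literal_le _ _) _
    _ = 3 * (D.P t).card := by simp; ring
    _ ≤ 3 * L := by
        have := Finset.card_le_univ (D.P t)
        simp only [Fintype.card_fin] at this
        omega

/-- `X t - 1` has complexity `≤ 1`. -/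
theorem complexity_X_sub_one_le (t : Fin n) :
    complexity (X (Sum.inl (Sum.inl t)) - 1 : MvPolynomial ((Fin n ⊕ Fin 0) ⊕ Fin L) ℂ) ≤ 1 := by
  have h1 : (X (Sum.inl (Sum.inl t)) - 1 : MvPolynomial ((Fin n ⊕ Fin 0) ⊕ Fin L) ℂ) =
      X (Sum.inl (Sum.inl t)) + C (-1) := by
    rw [C_neg, C_1, sub_eq_add_neg]
  rw [h1]
  calc complexity (X (Sum.inl (Sum.inl t)) + C (-1) : MvPolynomial ((Fin n ⊕ Fin 0) ⊕ Fin L) ℂ)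
      ≤ complexity (X (Sum.inl (Sum.inl t)) : MvPolynomial ((Fin n ⊕ Fin 0) ⊕ Fin L) ℂ) +
          complexity (C (-1) : MvPolynomial ((Fin n ⊕ Fin 0) ⊕ Fin L) ℂ) + 1 :=
        complexity_add_le_holds _ _
    _ = 1 := by rw [complexity_X_holds, complexity_C_holds]

/-- The witness has complexity `≤ n * (3 * L + 5)`. -/
theorem complexity_witness_le : complexity D.witness ≤ n * (3 * L + 5) := by
  unfold witness
  refine (complexity_finset_prod_le _ _).trans ?_
  calc ∑ t : Fin n, complexity (1 + (X (Sum.inl (Sum.inl t)) - 1) * D.lit t) +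
          (univ : Finset (Fin n)).card
      ≤ ∑ _t : Fin n, (3 * L + 4) + (univ : Finset (Fin n)).card := by
        refine Nat.add_le_add_right (Finset.sum_le_sum fun t _ => ?_) _
        calc complexity (1 + (X (Sum.inl (Sum.inl t)) - 1) * D.lit t)
            ≤ complexity (1 : MvPolynomial ((Fin n ⊕ Fin 0) ⊕ Fin L) ℂ) +
                complexity ((X (Sum.inl (Sum.inl t)) - 1) * D.lit t) + 1 :=
              complexity_add_le_holds _ _
          _ ≤ 0 + (1 + 3 * L + 1) + 1 := by
              gcongr
              · rw [← C_1, complexity_C_holds]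
              · exact (complexity_mul_le_holds _ _).trans
                  (by have := complexity_X_sub_one_le (L := L) t
                      have := D.complexity_lit_le t
                      omega)
          _ ≤ 3 * L + 4 := by omega
    _ = n * (3 * L + 5) := by simp; ring

end SoloPattern

/-! ### Definability of pattern-design maps (Raz Def. 1.3 with `ℓ = 0`) -/

/-- **Pattern-design monomial maps are poly(`n`)-definable.**  For any family of pattern designs
`D n` on `n` positions read by the `⌈log₂ m n⌉` bits of the index, with `⌈log₂ m n⌉`
polynomially bounded in `n`, the monomial map family `f n i = ∏_{t ∈ (D n).S i} x_t`
(`soloDesignMap`) is `IsPolyDefinableMap` (Raz 2010, Def. 1.3): witness `g n = (D n).witness`,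
`ℓ = 0`. [cite: Raz2010, Def. 1.3] -/
theorem soloInformed_isPolyDefinableMap_pattern {m : ℕ → ℕ}
    (D : ∀ n, SoloPattern n (Nat.clog 2 (m n))) (hm : IsPBounded fun n => Nat.clog 2 (m n)) :
    IsPolyDefinableMap (m := m) (σ := fun n => Fin n)
      fun n => soloDesignMap fun i : Fin (m n) => (D n).S i := by
  refine ⟨fun _ => 0, fun n => (D n).witness, IsPBounded.const 0, ?_, ?_, ?_⟩
  · exact (IsPBounded.mul_holds IsPBounded.id (IsPBounded.add_holds hm (IsPBounded.const 1))).mono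
      fun n => (D n).totalDegree_witness_le
  · exact (IsPBounded.mul_holds IsPBounded.id (IsPBounded.add_holds
      (IsPBounded.mul_holds (IsPBounded.const 3) hm) (IsPBounded.const 5))).mono
      fun n => (D n).complexity_witness_le
  · intro n i
    rw [SoloPattern.bitSubst_eq_bits, SoloPattern.bits_witness, boolSum_rename_inl_zero]
    rfl

/-! ### The subpattern design and its private points -/

namespace SoloPattern

/-- The position type of the subpattern design: a `(K-1)`-subset `J` of the `L` bit positions and
a pattern `u ∈ {0,1}^{K-1}` on it (read through the increasing enumeration of `J`). -/
abbrev Pos (L K : ℕ) : Type := {J : Finset (Fin L) // J.card = K - 1} × (Fin (K - 1) → Bool)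

/-- `|Pos L K| = C(L, K-1) · 2^{K-1}`. -/
theorem card_Pos (L K : ℕ) : Fintype.card (Pos L K) = Nat.choose L (K - 1) * 2 ^ (K - 1) := by
  classical
  rw [Fintype.card_prod, Fintype.card_fun, Fintype.card_bool, Fintype.card_fin]
  congr 1
  rw [Fintype.card_subtype]
  have : (univ.filter fun J : Finset (Fin L) => J.card = K - 1) = powersetCard (K - 1) univ := by
    ext J; simp [mem_powersetCard]
  rw [this, card_powersetCard, card_univ, Fintype.card_fin]

/-- The pattern of a position `(J, u)` as a function on all bit positions (`false` off `J`). -/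
def patV {L K : ℕ} (Ju : Pos L K) : Fin L → Bool := fun p =>
  if hp : p ∈ Ju.1.1 then Ju.2 ((Ju.1.1.orderIsoOfFin Ju.1.2).symm ⟨p, hp⟩) else false

/-- Decoding a position of `Fin n` (positions beyond `|Pos L K|` are unused). -/
def decode (n L K : ℕ) (t : Fin n) : Option (Pos L K) :=
  if h : (t : ℕ) < Fintype.card (Pos L K) then some ((Fintype.equivFin (Pos L K)).symm ⟨t, h⟩)
  else none

/-- **The subpattern design** on `n` positions, `L` index bits, order `K`: position `(J, u)` tests
the bits in `J` against `u`; unused positions test nothing (and so belong to every set). -/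
def subpattern (n L K : ℕ) : SoloPattern n L where
  P t := match decode n L K t with
    | some Ju => Ju.1.1
    | none => ∅
  v t := match decode n L K t with
    | some Ju => patV Ju
    | none => fun _ => false

/-- Encoding a position into `Fin n` when there is room. -/
def encode {n L K : ℕ} (h : Fintype.card (Pos L K) ≤ n) (Ju : Pos L K) : Fin n :=
  Fin.castLE h (Fintype.equivFin (Pos L K) Ju)

/-- `decode` inverts `encode`. -/
theorem decode_encode {n L K : ℕ} (h : Fintype.card (Pos L K) ≤ n) (Ju : Pos L K) :
    decode n L K (encode h Ju) = some Ju := by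
  unfold decode encode
  have hlt : ((Fin.castLE h (Fintype.equivFin (Pos L K) Ju) : Fin n) : ℕ) <
      Fintype.card (Pos L K) := by
    rw [Fin.val_castLE]; exact (Fintype.equivFin (Pos L K) Ju).isLt
  rw [dif_pos hlt]
  congr 1
  apply (Fintype.equivFin (Pos L K)).injective
  rw [Equiv.apply_symm_apply]
  ext; simp only [Fin.val_castLE]

/-- The bit positions tested at the position encoding `(J, u)` are `J`. -/
theorem subpattern_P_encode {n L K : ℕ} (h : Fintype.card (Pos L K) ≤ n) (Ju : Pos L K) :
    (subpattern n L K).P (encode h Ju) = Ju.1.1 := by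
  simp only [subpattern, decode_encode h Ju]

/-- The pattern tested at the position encoding `(J, u)` is `u` transported to `J`. -/
theorem subpattern_v_encode {n L K : ℕ} (h : Fintype.card (Pos L K) ≤ n) (Ju : Pos L K) :
    (subpattern n L K).v (encode h Ju) = patV Ju := by
  simp only [subpattern, decode_encode h Ju]

/-- The pattern read off an index `i` on `J` reproduces the bits of `i` on `J`. -/
theorem patV_ofBits {L K : ℕ} (J : Finset (Fin L)) (hJ : J.card = K - 1) (i : ℕ) (p : Fin L)
    (hp : p ∈ J) :
    patV (⟨⟨J, hJ⟩, fun r => i.testBit ((J.orderIsoOfFin hJ r : J) : Fin L)⟩ : Pos L K) p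
      = i.testBit p := by
  simp only [patV, dif_pos hp, OrderIso.apply_symm_apply]

/-- **Private points of the subpattern design.**  If `2 ≤ K`, `K - 1 ≤ L`, the positions fit
(`C(L, K-1) · 2^{K-1} ≤ n`) and the indices are `< m ≤ 2^L`, then in every subfamily of at most
`K` members each member owns a position missed by the others. -/
theorem subpattern_privatePoints {n L K m : ℕ} (hK : 2 ≤ K) (hKL : K - 1 ≤ L)
    (hn : Fintype.card (Pos L K) ≤ n) (hm : m ≤ 2 ^ L) :
    ∀ T : Finset (Fin m), T.card ≤ K → ∀ i ∈ T,
      ∃ x ∈ (subpattern n L K).S i, ∀ j ∈ T, j ≠ i → x ∉ (subpattern n L K).S j := by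
  classical
  intro T hT i hi
  -- a distinguishing bit for every other index
  have hdiff : ∀ j : Fin m, j ≠ i → ∃ p : Fin L, (j : ℕ).testBit p ≠ (i : ℕ).testBit p := by
    intro j hji
    by_contra hcon
    push Not at hcon
    exact hji (Fin.ext (eq_of_testBit_eq_of_lt (lt_of_lt_of_le j.2 hm) (lt_of_lt_of_le i.2 hm) hcon))
  haveI : Nonempty (Fin L) := ⟨⟨0, by omega⟩⟩
  choose! f hf using hdiff
  set J' : Finset (Fin L) := (T.erase i).image f with hJ'
  have hJ'card : J'.card ≤ K - 1 := by
    calc J'.card ≤ (T.erase i).card := Finset.card_image_le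
      _ = T.card - 1 := Finset.card_erase_of_mem hi
      _ ≤ K - 1 := by omega
  obtain ⟨J, hJ'J, -, hJcard⟩ := Finset.exists_subsuperset_card_eq (Finset.subset_univ J') hJ'card
    (by simpa using hKL)
  let Ju : Pos L K := ⟨⟨J, hJcard⟩, fun r => (i : ℕ).testBit ((J.orderIsoOfFin hJcard r : J) : Fin L)⟩
  refine ⟨encode hn Ju, ?_, ?_⟩
  · rw [mem_S, subpattern_P_encode, subpattern_v_encode]
    intro p hp
    exact (patV_ofBits J hJcard i p hp).symm
  · intro j hj hji hmem
    rw [mem_S, subpattern_P_encode, subpattern_v_encode] at hmem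
    have hfj : f j ∈ J := hJ'J (Finset.mem_image.2 ⟨j, Finset.mem_erase.2 ⟨hji, hj⟩, rfl⟩)
    have h1 := hmem (f j) hfj
    rw [patV_ofBits J hJcard i (f j) hfj] at h1
    exact hf j hji h1

end SoloPattern

end Summit.ValiantsHypothesis.ValiantsHypothesis.Theorems
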